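import Literature.NumberTheory.PAdicHodge.WeilTowerAlternating
import Literature.NumberTheory.EllipticCurves.TateModuleProjSurjectiveProofs
import HarnessLib

/-!
# A levelwise non-degenerate, levelwise alternating Weil tower is non-degenerate on `T_pW`

Topic `Literature/NumberTheory/PAdicHodge`; THEOREMS ONLY (no definition, no named fact, no instance, no `sorry`). Discharge of the
hypothesis `henondeg` of `LegendreOfPeriodHoms.exists_legendre_of_periodHoms` / the capstone `TatePairingPointOfKTwo` from the
LEVELWISE right-non-degeneracy `(∀ S, e_k(S, T) = 1) → T = 0` (the hypothesis `hnondeg` carried by every Weil tower of the tree) and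
levelwise alternation: `(∀ U, e_∞(S, U) = 0) → S = 0` (`weilContPairingPadic_toLin_nondegenerate`; antisymmetry
`WeilTowerAlternating`, surjectivity of `T_pW → E[p^k]` `proj_surjective_of_isAlgClosed_holds`, `TateModule.ext`).

Line `kato_lever` of crux K★ `stmt-BirchSwinnertonDyer-22226`; BSD / K★ are NOT proved by this file.

## References
* J. H. Silverman, *AEC* (2009), Prop. III.8.1 (a), (c), (d), III §7. [SilvermanAEC2009]
-/

noncomputable section

open Field Function ValuativeRel WittVector

namespace Literature.NumberTheory.PAdicHodge

open Literature.NumberTheory.GaloisRepresentations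
open Literature.NumberTheory.GaloisRepresentations.IsNonarchimedeanLocalField
open Literature.NumberTheory.GaloisCohomology
open Literature.NumberTheory.EllipticCurves
open _root_.WeierstrassCurve

variable {F : Type} [Field F] [ValuativeRel F] [TopologicalSpace F] [IsNonarchimedeanLocalField F]
  {p : ℕ} [Fact p.Prime] {K₀ : Type} [Field K₀] [Algebra K₀ F] (W : WeierstrassCurve K₀)
  (e : (k : ℕ) → geomTorsion W ((p ^ k : ℕ) : ℤ) → geomTorsion W ((p ^ k : ℕ) : ℤ) → AlgebraicClosure K₀)
  (hμ : ∀ k S T, e k S T ^ (p ^ k) = 1) (hadd₁ : ∀ k S₁ S₂ T, e k (S₁ + S₂) T = e k S₁ T * e k S₂ T)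
  (hadd₂ : ∀ k S T₁ T₂, e k S (T₁ + T₂) = e k S T₁ * e k S T₂)
  (hgal : ∀ k (σ : absoluteGaloisGroup K₀) (S T : geomTorsion W ((p ^ k : ℕ) : ℤ)), σ • e k S T = e k (σ • S) (σ • T))
  (hcompat : ∀ k (S T : geomTorsion W ((p ^ (k + 1) : ℕ) : ℤ)),
    e k (torsionMulHom W (p ^ (k + 1)) (p ^ k) p (pow_succ p k).symm S)
      (torsionMulHom W (p ^ (k + 1)) (p ^ k) p (pow_succ p k).symm T) = e (k + 1) S T ^ p)

omit [ValuativeRel F] [TopologicalSpace F] [IsNonarchimedeanLocalField F] in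
/-- ★ **Non-degeneracy of `e_∞` on `T_pW`** from levelwise non-degeneracy and alternation: if `e_∞(S, U) = 0` for all `U ∈ T_pW` then
`S = 0`. [cite: SilvermanAEC2009, Prop. III.8.1 (c), (d) and III §7] -/
theorem weilContPairingPadic_toLin_nondegenerate [W.IsElliptic]
    (halt : ∀ k (S : geomTorsion W ((p ^ k : ℕ) : ℤ)), e k S S = 1)
    (hnondeg : ∀ k (T : geomTorsion W ((p ^ k : ℕ) : ℤ)), (∀ S, e k S T = 1) → T = 0)
    (S : W.tateModule p) (hS : ∀ U, (weilContPairingPadic W F p e hμ hadd₁ hadd₂ hgal hcompat).toLin S U = 0) : S = 0 := by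
  refine TateModule.ext fun k => ?_
  rw [map_zero]
  -- `e_k(S', pr_k S) = 1` for every `S' ∈ E[p^k]` (`S' = pr_k U`, antisymmetry, `hS U`)
  have hk : (tateProjHom W p k S) = 0 := by
    refine hnondeg k _ fun S' => ?_
    obtain ⟨U, hU⟩ := proj_surjective_of_isAlgClosed_holds W p k S'.2
    have hUS : (weilContPairingPadic W F p e hμ hadd₁ hadd₂ hgal hcompat).toLin U S = 0 := by
      rw [weilContPairingPadic_toLin_swap (F := F) W e hμ hadd₁ hadd₂ hgal hcompat halt S U, hS U, neg_zero]
    have hcoord : weilPairingPadicCoord W F p e hμ hadd₁ hadd₂ k U S = 0 := by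
      have := congrArg (fun z : (muPadicSystem F p).limit => z.1 k) hUS
      exact this
    have hval := coe_muVal_weilPairingPadicCoord W F p e hμ hadd₁ hadd₂ k U S
    rw [hcoord, muVal_zero, Units.val_one] at hval
    have hS' : (S' : geomPoints W) = tateProjHom W p k U := by rw [← hU]; rfl
    have hSeq : S' = tateProjHom W p k U := Subtype.ext hS'
    rw [hSeq]
    exact (absClosureEmbedding K₀ F).injective (hval.symm.trans (map_one (absClosureEmbedding K₀ F)).symm)
  have := congrArg Subtype.val hk
  exact this

end Literature.NumberTheory.PAdicHodge

end
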